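import Literature.AnabelianGeometry.SemiGraphs.TemperedDecompositionInternal
import Literature.AnabelianGeometry.SemiGraphs.PSCMapAlongEquivTransfer
import Literature.AnabelianGeometry.SemiGraphs.TemperedCurvePuncturedDiscNonVacuity
import Literature.AnabelianGeometry.SemiGraphs.TemperedDeltaTempTransport
import HarnessLib

/-!
# [SemiAnbd] Theorem 6.5 (iii) «follows from Corollary 3.11»: the reduction in the kernel

Mochizuki, *Semi-graphs of anabelioids*, Publ. RIMS **42** (2006) [SemiAnbd], §6, Theorem 6.5 (iii)
(Absoluteness of Cuspidal Decomposition Groups), author's manuscript p. 72: «Every isomorphism of tempered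
groups `α : Π^temp_{X_K} ⥲ Π^temp_{Y_L}` preserves cuspidal decomposition groups and cuspidal geometric
decomposition groups.»  Printed proof, p. 72 l. 14: «Assertion (iii) follows from Corollary 3.11.»
[cite: MochizukiSemiAnbd2006, Thm 6.5(iii) p.72]  Corollary 3.11 (Reconstruction of Semi-graphs of
Anabelioids Associated to Pointed Stable Curves), p. 45: «any isomorphism of topological groups
`γ : Δ[α] ⥲ Δ[β]` [of the GEOMETRIC tempered fundamental groups] determines a compatible isomorphism of
semi-graphs of anabelioids `𝒢^c[α] ⥲ 𝒢^c[β]` in a fashion that is functorial with respect to `γ`»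
[cite: MochizukiSemiAnbd2006, Cor 3.11 p.45] — the cusps being the open edges of `𝒢^c` and the cuspidal
geometric decomposition groups `I_x ⊆ Δ^temp_X` their edge-like subgroups (Example 3.10, p. 43).

PROOF-ONLY companion of `TemperedOrigin.lean` / `TemperedAnabelian.lean` (abc-iut cell, L-F pack D
[SemiAnbd] §6, seat abc-iut-L3-d2; FACT-LIST row F-1704 `TemperedOrigin.CuspidalAbsolutenessHolds`;
theorems only — no `def`, no `instance`, no new named fact; the frozen interface files are imported, never
edited).  The universal closure `∀ Ω, Ω.CuspidalAbsolutenessHolds` is REFUTED in the tree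
(`TemperedCurve.not_forall_cuspidalAbsolutenessHolds`), and the typed per-datum predicate
`IsoPreservesCuspidalDecomp X X` even FAILS at the product datum `G_{ℚ_p} × F̂₂`
(`exists_temperedCurve_not_isoPreservesCuspidalDecomp`, abc-iut-w5-d040): the statement has content only
at data coming from curves.  This file supplies the row's positive REDUCTION to the inputs its printed
proof uses, as kernel theorems over the §6 interface `TemperedCurve p`:

* `isoPreservesCuspidalDecomp_of_inertia` — the DECOMPOSITION-GROUP half of (iii) is formal from the
  INERTIA half and Thm. 6.5 (ii), second sentence (`DecompEqCommensuratorOfOpenInertia`, a clause of the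
  row F-1708, REDUCED in the tree to [Mzk8] Thm. 1.3: `temperedDecompositionGroupsHolds_of_profinite₄`):
  `D_x = C_{Π^temp}(I_x)` (`commensurator_inertia_eq_decomp`), commensurators transport along `α`
  (`Subgroup.Commensurable.commensurator_map_equiv`) and along conjugation (`commensurator_conjAct_smul`),
  so `α(γ D_x γ⁻¹) = α(γ) C(α I_x) α(γ)⁻¹ = (α(γ) δ) D_y (α(γ) δ)⁻¹` once `α(I_x) = δ I_y δ⁻¹`;
* `inertia_map_iso_of_delta` — the inertia half for isomorphisms `α` of the ARITHMETIC tempered groups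
  from the Cor. 3.11 leaf for isomorphisms `γ : Δ^temp_X ⥲ Δ^temp_Y` of the GEOMETRIC ones (printed
  form: «any isomorphism of topological groups `γ : Δ[α] ⥲ Δ[β]`»), by restricting `α` to `Δ^temp`
  (the [AbsAnab] Lem. 1.3.8-type law `α(Δ^temp_X) = Δ^temp_Y`, kept an explicit binder `hΔ` as in the
  cell's Thm. 6.8 transport files);
* `isoPreservesCuspidalDecomp_of_cor311` (per datum) and the origin-quantified
  `TemperedOrigin.cuspidalAbsolutenessHolds_of_cor311` — F-1704 from F-1708 BY NAME
  (`Ω.TemperedDecompositionGroupsHolds`), `hΔ`, and the Cor. 3.11 leaf `h311`;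
* `inertia_leaf_of_isoPreservesCuspidalDecomp` — conversely the `Π^temp`-level inertia leaf is a special
  case of the typed conclusion (so the reduction does not strengthen the row);
* `TemperedOrigin.exists_principal_cor311Leaves` — NON-VACUITY of the binder list: at the principal
  certificate of the tree's datum of punctured-disc type (abc-iut-f-168's
  `TemperedOrigin.exists_principal_cusped_allHolds`: a `K`-rational cusp, `I_x = Δ^temp_X` central) the
  three binders `h65`, `hΔ`, `h311` hold together, and the closer yields F-1704 there (consistency
  evidence for the joint typing only; toy datum, not a curve).

The leaf `h311` — «isomorphisms of the geometric tempered fundamental groups carry cuspidal geometric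
decomposition groups to cuspidal geometric decomposition groups» — is Cor. 3.11 read through Ex. 3.10
(cusps = open edges of `𝒢^c`, `I_x` = their edge-like subgroups, for all members of the tower); it is NOT
derivable over the interface (it fails at the product datum, where the completed swap of the free
generators is an automorphism of `Δ^temp = F̂₂` moving `îa(Ẑ)` off its conjugacy class) and is carried as
an explicit binder with its exact Lean signature (GAP-row material for the lead), never as a new
`def … : Prop`.

HONEST FRAMING.  Elementary group theory and point-set topology over the interface; nothing of Cor. 3.11
/ [Mzk8] is proved here (they are INPUTS), nothing is asserted for curves, and nothing here concerns the
disputed parts of inter-universal Teichmüller theory or takes a side on [IUTchIII] Cor. 3.12;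
typed ≠ proved.
-/

noncomputable section

namespace Literature.AnabelianGeometry.SemiGraphs

namespace TemperedCurve

open scoped Pointwise
open _root_.Topology
open _root_.Subgroup.Commensurable (commensurator)

variable {p : ℕ} [Fact p.Prime] (X Y : TemperedCurve p)

/-! ### Bookkeeping along an isomorphism `α : Π^temp_{X_K} ⥲ Π^temp_{Y_L}` -/

/-- `α(γ H γ⁻¹) = α(γ) α(H) α(γ)⁻¹` for the `ConjAct`-action on subgroups.
[cite: MochizukiSemiAnbd2006, Thm 6.5(iii) p.72] -/
theorem map_iso_conjAct_smul (α : X.PiTemp ≃ₜ* Y.PiTemp) (γ : ConjAct X.PiTemp)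
    (H : Subgroup X.PiTemp) :
    (γ • H).map α.toMulEquiv.toMonoidHom =
      ConjAct.toConjAct (α (ConjAct.ofConjAct γ)) • H.map α.toMulEquiv.toMonoidHom := by
  have h := map_conjAct_smul α.toMulEquiv.toMonoidHom (ConjAct.ofConjAct γ) H
  rw [ConjAct.toConjAct_ofConjAct] at h
  exact h

/-- At a cusp `x`, `α(D_x) = C_{Π^temp_{Y_L}}(α(I_x))`: Thm. 6.5 (ii), second sentence, gives
`D_x = C_{Π^temp_{X_K}}(I_x)` and commensurators transport along the isomorphism `α`.
[cite: MochizukiSemiAnbd2006, Thm 6.5(ii)-(iii) pp.71-72] -/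
theorem map_iso_decomp_eq_commensurator (hX : X.DecompEqCommensuratorOfOpenInertia)
    (α : X.PiTemp ≃ₜ* Y.PiTemp) {x : X.Pt} (hx : X.IsCusp x) :
    (X.decomp x).map α.toMulEquiv.toMonoidHom =
      commensurator ((X.inertia x).map α.toMulEquiv.toMonoidHom) := by
  rw [Subgroup.Commensurable.commensurator_map_equiv, X.commensurator_inertia_eq_decomp hX hx]

/-! ### The decomposition-group half of (iii) from the inertia half and Thm. 6.5 (ii) -/

/-- **[SemiAnbd] Thm. 6.5 (iii) for the pair `(X, Y)`** — the typed node `X.IsoPreservesCuspidalDecomp Y`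
(both clauses, for EVERY isomorphism `α` of the arithmetic tempered groups) — from: Thm. 6.5 (ii), second
sentence, for `X` and for `Y` (`DecompEqCommensuratorOfOpenInertia`; tree: reduced to [Mzk8] Thm. 1.3),
and the INERTIA LEAF «every `α` carries each cuspidal inertia `I_x` to a `Π^temp_{Y_L}`-conjugate of some
cuspidal inertia `I_y`».  The decomposition-group clause is then formal: `D_x = C(I_x)`, `D_y = C(I_y)`,
and commensurators commute with `α` and with conjugation. [cite: MochizukiSemiAnbd2006, Thm 6.5(iii) p.72] -/
theorem isoPreservesCuspidalDecomp_of_inertia (hX : X.DecompEqCommensuratorOfOpenInertia)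
    (hY : Y.DecompEqCommensuratorOfOpenInertia)
    (hI : ∀ α : X.PiTemp ≃ₜ* Y.PiTemp, ∀ x : X.Pt, X.IsCusp x →
      ∃ y : Y.Pt, Y.IsCusp y ∧ ∃ δ : ConjAct Y.PiTemp,
        (X.inertia x).map α.toMulEquiv.toMonoidHom = δ • Y.inertia y) :
    X.IsoPreservesCuspidalDecomp Y := by
  intro α D
  constructor
  · rintro ⟨x, hx, γ, rfl⟩
    obtain ⟨y, hy, δ, hδ⟩ := hI α x hx
    refine ⟨y, hy, ConjAct.toConjAct (α (ConjAct.ofConjAct γ)) * δ, ?_⟩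
    rw [map_iso_conjAct_smul, X.map_iso_decomp_eq_commensurator Y hX α hx, hδ,
      commensurator_conjAct_smul, Y.commensurator_inertia_eq_decomp hY hy, mul_smul]
  · rintro ⟨x, hx, γ, rfl⟩
    obtain ⟨y, hy, δ, hδ⟩ := hI α x hx
    refine ⟨y, hy, ConjAct.toConjAct (α (ConjAct.ofConjAct γ)) * δ, ?_⟩
    rw [map_iso_conjAct_smul, hδ, mul_smul]

/-- Conversely, the inertia leaf is the special case `I = I_x` of the second clause of the typed node —
the reduction `isoPreservesCuspidalDecomp_of_inertia` does not strengthen the row.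
[cite: MochizukiSemiAnbd2006, Thm 6.5(iii) p.72] -/
theorem inertia_leaf_of_isoPreservesCuspidalDecomp (h : X.IsoPreservesCuspidalDecomp Y)
    (α : X.PiTemp ≃ₜ* Y.PiTemp) {x : X.Pt} (hx : X.IsCusp x) :
    ∃ y : Y.Pt, Y.IsCusp y ∧ ∃ δ : ConjAct Y.PiTemp,
      (X.inertia x).map α.toMulEquiv.toMonoidHom = δ • Y.inertia y :=
  (h α (X.inertia x)).2 ⟨x, hx, 1, (one_smul _ _).symm⟩

/-! ### The inertia half from the Cor. 3.11 leaf on the geometric tempered groups -/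

/-- `I_x ⊆ Δ^temp_X` (`I_x := D_x ∩ Δ^temp_X`, p. 71). [cite: MochizukiSemiAnbd2006, §6 p.71] -/
theorem inertia_le_deltaTemp (x : X.Pt) : X.inertia x ≤ X.DeltaTemp := inf_le_right

/-- A conjugate of a cuspidal inertia lies in the normal subgroup `Δ^temp`.
[cite: MochizukiSemiAnbd2006, §6 p.71] -/
theorem conjAct_smul_inertia_le_deltaTemp (δ : ConjAct X.PiTemp) (x : X.Pt) :
    δ • X.inertia x ≤ X.DeltaTemp := by
  have hN : X.DeltaTemp.Normal := MonoidHom.normal_ker X.aug.toMonoidHom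
  calc δ • X.inertia x ≤ δ • X.DeltaTemp :=
        Subgroup.pointwise_smul_le_pointwise_smul_iff.mpr (X.inertia_le_deltaTemp x)
    _ = X.DeltaTemp := hN.conjAct δ

/-- **The inertia half of Thm. 6.5 (iii) from the Cor. 3.11 leaf.**  If every isomorphism of topological
groups `γ : Δ^temp_X ⥲ Δ^temp_Y` carries each cuspidal geometric decomposition group `I_x` onto a
`Π^temp_{Y_L}`-conjugate of some `I_y` (Cor. 3.11 through Ex. 3.10: cusps = open edges of `𝒢^c`, `I_x` =
their edge-like subgroups), and every isomorphism `α : Π^temp_{X_K} ⥲ Π^temp_{Y_L}` satisfies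
`α(Δ^temp_X) = Δ^temp_Y` ([AbsAnab] Lem. 1.3.8-type law), then every `α` carries `I_x` onto a conjugate of
some `I_y` — by restricting `α` to `Δ^temp`. [cite: MochizukiSemiAnbd2006, Thm 6.5(iii) p.72] -/
theorem inertia_map_iso_of_delta
    (hΔ : ∀ α : X.PiTemp ≃ₜ* Y.PiTemp, X.DeltaTemp.map α.toMulEquiv.toMonoidHom = Y.DeltaTemp)
    (h311 : ∀ γ : X.DeltaTemp ≃ₜ* Y.DeltaTemp, ∀ x : X.Pt, X.IsCusp x →
      ∃ y : Y.Pt, Y.IsCusp y ∧ ∃ δ : ConjAct Y.PiTemp,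
        ((X.inertia x).subgroupOf X.DeltaTemp).map γ.toMulEquiv.toMonoidHom =
          (δ • Y.inertia y).subgroupOf Y.DeltaTemp)
    (α : X.PiTemp ≃ₜ* Y.PiTemp) {x : X.Pt} (hx : X.IsCusp x) :
    ∃ y : Y.Pt, Y.IsCusp y ∧ ∃ δ : ConjAct Y.PiTemp,
      (X.inertia x).map α.toMulEquiv.toMonoidHom = δ • Y.inertia y := by
  -- the restriction `γ := α|_{Δ^temp_X} : Δ^temp_X ⥲ Δ^temp_Y`, as an isomorphism of topological groups
  let e : X.DeltaTemp ≃* Y.DeltaTemp :=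
    (α.toMulEquiv.subgroupMap X.DeltaTemp).trans (MulEquiv.subgroupCongr (hΔ α))
  have he : ∀ g : X.DeltaTemp, ((e g : Y.DeltaTemp) : Y.PiTemp) = α (g : X.PiTemp) := fun g => rfl
  have hesymm : ∀ h : Y.DeltaTemp, α ((e.symm h : X.DeltaTemp) : X.PiTemp) = (h : Y.PiTemp) := fun h => by
    rw [← he (e.symm h), e.apply_symm_apply]
  have hcont : Continuous e := by
    refine continuous_induced_rng.2 ?_
    have : (Subtype.val ∘ e : X.DeltaTemp → Y.PiTemp) = fun g : X.DeltaTemp => α (g : X.PiTemp) :=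
      funext he
    rw [this]
    exact α.continuous.comp continuous_subtype_val
  have hcont' : Continuous e.symm := by
    refine continuous_induced_rng.2 ?_
    have : (Subtype.val ∘ e.symm : Y.DeltaTemp → X.PiTemp) =
        fun h : Y.DeltaTemp => α.symm (h : Y.PiTemp) := by
      funext h
      apply α.injective
      simp only [Function.comp_apply, hesymm, ContinuousMulEquiv.apply_symm_apply]
    rw [this]
    exact α.symm.continuous.comp continuous_subtype_val
  let γ : X.DeltaTemp ≃ₜ* Y.DeltaTemp :=
    { e with continuous_toFun := hcont, continuous_invFun := hcont' }
  obtain ⟨y, hy, δ, hδ⟩ := h311 γ x hx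
  refine ⟨y, hy, δ, ?_⟩
  -- push the identity `γ(I_x) = (δ I_y δ⁻¹) ∩ Δ^temp_Y` (inside `Δ^temp_Y`) forward along `Δ^temp_Y ↪ Π^temp`
  have hcomp : Y.DeltaTemp.subtype.comp γ.toMulEquiv.toMonoidHom =
      α.toMulEquiv.toMonoidHom.comp X.DeltaTemp.subtype := MonoidHom.ext he
  have h1 := congrArg (Subgroup.map Y.DeltaTemp.subtype) hδ
  rw [Subgroup.map_map, hcomp, ← Subgroup.map_map, Subgroup.subgroupOf_map_subtype,
    Subgroup.subgroupOf_map_subtype, inf_eq_left.mpr (X.inertia_le_deltaTemp x),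
    inf_eq_left.mpr (Y.conjAct_smul_inertia_le_deltaTemp δ y)] at h1
  exact h1

/-- **[SemiAnbd] Thm. 6.5 (iii) for the pair `(X, Y)` «from Corollary 3.11»** — the typed node
`X.IsoPreservesCuspidalDecomp Y` from: Thm. 6.5 (ii), second sentence, for `X` and `Y`; the law
`α(Δ^temp_X) = Δ^temp_Y` for isomorphisms of the arithmetic tempered groups; and the Cor. 3.11 leaf for
isomorphisms of the geometric tempered groups. [cite: MochizukiSemiAnbd2006, Thm 6.5(iii) p.72] -/
theorem isoPreservesCuspidalDecomp_of_cor311 (hX : X.DecompEqCommensuratorOfOpenInertia)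
    (hY : Y.DecompEqCommensuratorOfOpenInertia)
    (hΔ : ∀ α : X.PiTemp ≃ₜ* Y.PiTemp, X.DeltaTemp.map α.toMulEquiv.toMonoidHom = Y.DeltaTemp)
    (h311 : ∀ γ : X.DeltaTemp ≃ₜ* Y.DeltaTemp, ∀ x : X.Pt, X.IsCusp x →
      ∃ y : Y.Pt, Y.IsCusp y ∧ ∃ δ : ConjAct Y.PiTemp,
        ((X.inertia x).subgroupOf X.DeltaTemp).map γ.toMulEquiv.toMonoidHom =
          (δ • Y.inertia y).subgroupOf Y.DeltaTemp) :
    X.IsoPreservesCuspidalDecomp Y :=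
  X.isoPreservesCuspidalDecomp_of_inertia Y hX hY fun α _ hx => X.inertia_map_iso_of_delta Y hΔ h311 α hx

end TemperedCurve

/-! ### The FACT-LIST row F-1704, origin-quantified -/

namespace TemperedOrigin

open scoped Pointwise

variable {p : ℕ} [Fact p.Prime]

/-- **[SemiAnbd] Thm. 6.5 (iii) as printed** (the FACT-LIST row F-1704 `Ω.CuspidalAbsolutenessHolds`)
REDUCED to: the row F-1708 `Ω.TemperedDecompositionGroupsHolds` BY NAME (only its clause Thm. 6.5 (ii),
second sentence, is used; itself reduced to [Mzk8] Thm. 1.3 in the tree) and, for every pair of certified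
curves, the `Π^temp`-level inertia leaf «every isomorphism `Π^temp_{X_K} ⥲ Π^temp_{Y_L}` carries each
cuspidal inertia `I_x` onto a conjugate of some `I_y`». [cite: MochizukiSemiAnbd2006, Thm 6.5(iii) p.72] -/
theorem cuspidalAbsolutenessHolds_of_inertia (Ω : TemperedOrigin p)
    (h65 : Ω.TemperedDecompositionGroupsHolds)
    (hI : ∀ X Y : TemperedCurve p, Ω.IsHyperbolicCurveOrigin X → Ω.IsHyperbolicCurveOrigin Y →
      ∀ α : X.PiTemp ≃ₜ* Y.PiTemp, ∀ x : X.Pt, X.IsCusp x →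
        ∃ y : Y.Pt, Y.IsCusp y ∧ ∃ δ : ConjAct Y.PiTemp,
          (X.inertia x).map α.toMulEquiv.toMonoidHom = δ • Y.inertia y) :
    Ω.CuspidalAbsolutenessHolds := fun X Y hX hY =>
  X.isoPreservesCuspidalDecomp_of_inertia Y (h65 X hX).2.2.2.1 (h65 Y hY).2.2.2.1 (hI X Y hX hY)

/-- **[SemiAnbd] Thm. 6.5 (iii) as printed, «from Corollary 3.11»** (the FACT-LIST row F-1704
`Ω.CuspidalAbsolutenessHolds`) REDUCED TO ITS PRINTED INPUTS: the row F-1708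
`Ω.TemperedDecompositionGroupsHolds` BY NAME (clause (ii), second sentence), the [AbsAnab] Lem. 1.3.8-type
law `α(Δ^temp_X) = Δ^temp_Y` for isomorphisms of the arithmetic tempered groups of certified curves, and
the Cor. 3.11 leaf: every isomorphism of topological groups `γ : Δ^temp_X ⥲ Δ^temp_Y` between the
GEOMETRIC tempered fundamental groups of certified curves carries each cuspidal geometric decomposition
group `I_x` onto a `Π^temp_{Y_L}`-conjugate of some `I_y` («Assertion (iii) follows from Corollary 3.11»,
p. 72; Cor. 3.11 p. 45 with Ex. 3.10 p. 43).  The origin certificate is necessary (the universal closure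
over all `Ω` is refuted in the tree, and the leaf fails at the product datum `G_{ℚ_p} × F̂₂`); nothing of
Cor. 3.11 is proved here. [cite: MochizukiSemiAnbd2006, Thm 6.5(iii) p.72] -/
theorem cuspidalAbsolutenessHolds_of_cor311 (Ω : TemperedOrigin p)
    (h65 : Ω.TemperedDecompositionGroupsHolds)
    (hΔ : ∀ X Y : TemperedCurve p, Ω.IsHyperbolicCurveOrigin X → Ω.IsHyperbolicCurveOrigin Y →
      ∀ α : X.PiTemp ≃ₜ* Y.PiTemp, X.DeltaTemp.map α.toMulEquiv.toMonoidHom = Y.DeltaTemp)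
    (h311 : ∀ X Y : TemperedCurve p, Ω.IsHyperbolicCurveOrigin X → Ω.IsHyperbolicCurveOrigin Y →
      ∀ γ : X.DeltaTemp ≃ₜ* Y.DeltaTemp, ∀ x : X.Pt, X.IsCusp x →
        ∃ y : Y.Pt, Y.IsCusp y ∧ ∃ δ : ConjAct Y.PiTemp,
          ((X.inertia x).subgroupOf X.DeltaTemp).map γ.toMulEquiv.toMonoidHom =
            (δ • Y.inertia y).subgroupOf Y.DeltaTemp) :
    Ω.CuspidalAbsolutenessHolds := fun X Y hX hY =>
  X.isoPreservesCuspidalDecomp_of_cor311 Y (h65 X hX).2.2.2.1 (h65 Y hY).2.2.2.1 (hΔ X Y hX hY)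
    (h311 X Y hX hY)

/-! ### Non-vacuity of the binder list -/

/-- **The binders of `cuspidalAbsolutenessHolds_of_cor311` are jointly satisfiable at a certificate with a
cusp**: at the principal certificate `Ω := ⟨(· = X)⟩` of the tree's datum `X` of punctured-disc type
(`Π^temp = G_{ℚ_p} × Ẑ`, one `K`-rational cusp, `D_x = Π^temp`, `I_x = Δ^temp_X` the centre;
abc-iut-f-168's `TemperedOrigin.exists_principal_cusped_allHolds`) the row F-1708 holds,
`α(Δ^temp_X) = Δ^temp_X` for every automorphism `α` (the centre is characteristic),
and every automorphism of `Δ^temp_X` fixes `I_x = Δ^temp_X`; the closer then gives F-1704 at `Ω`.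
Consistency evidence for the joint typing only (toy datum with abelian `Δ^temp`, not a hyperbolic curve).
[cite: MochizukiSemiAnbd2006, Thm 6.5(iii) p.72] -/
theorem exists_principal_cor311Leaves (p : ℕ) [Fact p.Prime] :
    ∃ (X : TemperedCurve p) (Ω : TemperedOrigin p),
      (∀ Y, Ω.IsHyperbolicCurveOrigin Y ↔ Y = X) ∧ (∃ x : X.Pt, X.IsCusp x) ∧
      Ω.TemperedDecompositionGroupsHolds ∧
      (∀ X' Y' : TemperedCurve p, Ω.IsHyperbolicCurveOrigin X' → Ω.IsHyperbolicCurveOrigin Y' →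
        ∀ α : X'.PiTemp ≃ₜ* Y'.PiTemp, X'.DeltaTemp.map α.toMulEquiv.toMonoidHom = Y'.DeltaTemp) ∧
      (∀ X' Y' : TemperedCurve p, Ω.IsHyperbolicCurveOrigin X' → Ω.IsHyperbolicCurveOrigin Y' →
        ∀ γ : X'.DeltaTemp ≃ₜ* Y'.DeltaTemp, ∀ x : X'.Pt, X'.IsCusp x →
          ∃ y : Y'.Pt, Y'.IsCusp y ∧ ∃ δ : ConjAct Y'.PiTemp,
            ((X'.inertia x).subgroupOf X'.DeltaTemp).map γ.toMulEquiv.toMonoidHom =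
              (δ • Y'.inertia y).subgroupOf Y'.DeltaTemp) ∧
      Ω.CuspidalAbsolutenessHolds := by
  obtain ⟨X, Ω, hΩ, ⟨x₀, hx₀, -⟩, -, -, hpts, -, -, -, h65, -⟩ :=
    TemperedOrigin.exists_principal_cusped_allHolds p
  -- `Δ^temp_X = I_{x₀} = Z(Π^temp)` at this datum
  have hΔI : ∀ x : X.Pt, X.inertia x = X.DeltaTemp := fun x => by
    change X.decomp x ⊓ X.DeltaTemp = X.DeltaTemp
    rw [(hpts x).2.1, top_inf_eq]
  have hΔZ : X.DeltaTemp = Subgroup.center X.PiTemp := by rw [← hΔI x₀, (hpts x₀).2.2]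
  have hΔ : ∀ X' Y' : TemperedCurve p, Ω.IsHyperbolicCurveOrigin X' → Ω.IsHyperbolicCurveOrigin Y' →
      ∀ α : X'.PiTemp ≃ₜ* Y'.PiTemp, X'.DeltaTemp.map α.toMulEquiv.toMonoidHom = Y'.DeltaTemp := by
    intro X' Y' hX' hY' α
    obtain rfl := (hΩ X').1 hX'
    obtain rfl := (hΩ Y').1 hY'
    rw [hΔZ]
    exact Subgroup.characteristic_iff_map_eq.1 inferInstance α.toMulEquiv
  have h311 : ∀ X' Y' : TemperedCurve p, Ω.IsHyperbolicCurveOrigin X' → Ω.IsHyperbolicCurveOrigin Y' →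
      ∀ γ : X'.DeltaTemp ≃ₜ* Y'.DeltaTemp, ∀ x : X'.Pt, X'.IsCusp x →
        ∃ y : Y'.Pt, Y'.IsCusp y ∧ ∃ δ : ConjAct Y'.PiTemp,
          ((X'.inertia x).subgroupOf X'.DeltaTemp).map γ.toMulEquiv.toMonoidHom =
            (δ • Y'.inertia y).subgroupOf Y'.DeltaTemp := by
    intro X' Y' hX' hY' γ x hx
    obtain rfl := (hΩ X').1 hX'
    obtain rfl := (hΩ Y').1 hY'
    refine ⟨x, hx, 1, ?_⟩
    rw [one_smul, hΔI, Subgroup.subgroupOf_self, Subgroup.map_top_of_surjective _ γ.surjective]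
  exact ⟨X, Ω, hΩ, ⟨x₀, hx₀⟩, h65, hΔ, h311, Ω.cuspidalAbsolutenessHolds_of_cor311 h65 hΔ h311⟩

end TemperedOrigin

/-! ### v2 (append-only): the `hΔ` binder discharged to the profinite `Δ̂`-law (abc-iut-L3-t12's transport) -/

namespace TemperedCurve

open scoped Pointwise

variable {p : ℕ} [Fact p.Prime] (X Y : TemperedCurve p)

/-- **[SemiAnbd] Thm. 6.5 (iii) for the pair `(X, Y)`** with the `hΔ` binder of
`isoPreservesCuspidalDecomp_of_cor311` DISCHARGED to the profinite law «every isomorphism of profinite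
groups `Π_{X_K} ⥲ Π_{Y_L}` carries `Δ_X` onto `Δ_Y`» ([AbsAnab] Lem. 1.3.8-type, on the completions) through
abc-iut-L3-t12's `TemperedCurve.map_deltaTemp_eq_of_forall_map_deltaHat` (`TemperedDeltaTempTransport.lean`,
completion functoriality `exists_isoCompletion` + `Π^temp ∩ Δ = Δ^temp`).  Remaining binders: Thm. 6.5 (ii)
second sentence for `X`, `Y`, the profinite `Δ̂`-law, the Cor. 3.11 cusp leaf.
[cite: MochizukiSemiAnbd2006, Thm 6.5(iii) p.72] -/
theorem isoPreservesCuspidalDecomp_of_cor311_of_hatLaw (hX : X.DecompEqCommensuratorOfOpenInertia)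
    (hY : Y.DecompEqCommensuratorOfOpenInertia)
    (hhat : ∀ Φ : X.PiHat ≃ₜ* Y.PiHat, X.DeltaHat.map Φ.toMulEquiv.toMonoidHom = Y.DeltaHat)
    (h311 : ∀ γ : X.DeltaTemp ≃ₜ* Y.DeltaTemp, ∀ x : X.Pt, X.IsCusp x →
      ∃ y : Y.Pt, Y.IsCusp y ∧ ∃ δ : ConjAct Y.PiTemp,
        ((X.inertia x).subgroupOf X.DeltaTemp).map γ.toMulEquiv.toMonoidHom =
          (δ • Y.inertia y).subgroupOf Y.DeltaTemp) :
    X.IsoPreservesCuspidalDecomp Y :=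
  X.isoPreservesCuspidalDecomp_of_cor311 Y hX hY
    (fun α => X.map_deltaTemp_eq_of_forall_map_deltaHat Y α hhat) h311

end TemperedCurve

namespace TemperedOrigin

open scoped Pointwise

variable {p : ℕ} [Fact p.Prime]

/-- **[SemiAnbd] Thm. 6.5 (iii) as printed** (the FACT-LIST row F-1704 `Ω.CuspidalAbsolutenessHolds`) with the
`hΔ` binder of `cuspidalAbsolutenessHolds_of_cor311` DISCHARGED, BY NAME, to abc-iut-L3-t12's origin-level
transport `TemperedOrigin.map_deltaTemp_eq_of_hatLaw`: REDUCED to the row F-1708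
`Ω.TemperedDecompositionGroupsHolds` (clause Thm. 6.5 (ii), second sentence), the PROFINITE law «every
isomorphism of profinite groups `Π_{X_K} ⥲ Π_{Y_L}` between the completions of certified curves carries `Δ_X`
onto `Δ_Y`» ([AbsAnab] Lem. 1.3.8-type; F-0007 `FundamentalExtension.PreservesGeom` in `TemperedCurve`
currency), and the Cor. 3.11 cusp leaf (GAP-LEDGER G-L3d2g4-1).
[cite: MochizukiSemiAnbd2006, Thm 6.5(iii) p.72] -/
theorem cuspidalAbsolutenessHolds_of_cor311_of_hatLaw (Ω : TemperedOrigin p)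
    (h65 : Ω.TemperedDecompositionGroupsHolds)
    (hhat : ∀ X Y : TemperedCurve p, Ω.IsHyperbolicCurveOrigin X → Ω.IsHyperbolicCurveOrigin Y →
      ∀ Φ : X.PiHat ≃ₜ* Y.PiHat, X.DeltaHat.map Φ.toMulEquiv.toMonoidHom = Y.DeltaHat)
    (h311 : ∀ X Y : TemperedCurve p, Ω.IsHyperbolicCurveOrigin X → Ω.IsHyperbolicCurveOrigin Y →
      ∀ γ : X.DeltaTemp ≃ₜ* Y.DeltaTemp, ∀ x : X.Pt, X.IsCusp x →
        ∃ y : Y.Pt, Y.IsCusp y ∧ ∃ δ : ConjAct Y.PiTemp,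
          ((X.inertia x).subgroupOf X.DeltaTemp).map γ.toMulEquiv.toMonoidHom =
            (δ • Y.inertia y).subgroupOf Y.DeltaTemp) :
    Ω.CuspidalAbsolutenessHolds :=
  Ω.cuspidalAbsolutenessHolds_of_cor311 h65 (TemperedOrigin.map_deltaTemp_eq_of_hatLaw Ω hhat) h311

end TemperedOrigin

end Literature.AnabelianGeometry.SemiGraphs

end
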